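import Summits.Ventures.PercRepro.RankLevelSetRuleQMonotoneRatio
import Summits.Ventures.PercRepro.RankLevelSetRuleQFullUniform

/-!
# PercRepro — THE WHOLE UNTRUNCATED REGIME OF EVERY FAMILY `k` FOLLOWS FROM ITS CORNER `#P = q − k + 1`, UNIFORMLY IN `k`
(p4, gen 28; C-044; paper proofs/P4-CELL-THREE.md §13.11)

For `k ≥ 3` and every `q`, write `f(m) = R̂(q,k,m) − Φ(q+k,q)` on the untruncated regime `m ≤ q − k + 1` (`rhat_eq_sumW`:
`R̂ = Σ_{0<i<k} C(q+k−m, i)·W_i(q,m)`, `W_i = sumW q m i`).  Moving one element of the `n = q+k−m` "A-side" elements to the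
`m` "B-side" ones gives the **first-difference identity** `rhatSumW_succ`:
`f(m+1) − f(m) = C(q+k−m−1, k−1)·W_k(q,m) − W_1(q,m) =: δ(m)` (the `Φ` cancels), and the monotone ratio of
RankLevelSetRuleQMonotoneRatio says that `δ` changes sign at most once, from `+` to `−` (`tilted_delta_propagate`): once
`C(N,k−1)·W_k ≤ W_1` it stays so.  Hence `f` is unimodal with `f(0) = 0` (`m = 0` is the equality case of (R̂)), so
`f(m) ≥ min(f(0), f(q−k+1)) = min(0, f(corner))` (`tilted_unimodal_nonneg`):

**`rhat_whole_of_corner`: if `Φ(q+k,q) ≤ R̂(q, k, q+1−k)` then `Φ(q+k,q) ≤ R̂(q,k,m)` for every `m ≤ q+1−k`** — for every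
`k ≥ 3` and every `q ≥ k − 1`.  The uniform-in-`k` theorem on the whole untruncated regime is therefore equivalent to its
corner case `u = q − m = k − 1` (`n = 2k − 1`); `rhat_whole_of_row_one_corner` combines it with the tree's row-`J = 1`
criterion (RankLevelSetRuleQFullUniform) at the corner, which holds for `q ≲ k² − 2k`.  Axioms standard.
-/

namespace PercRepro

open Finset

/-- `Σ_{0<i<k} g i = Σ_{j<k−1} g (j+1)` (`ℚ`-valued). -/
lemma sumIooZeroRat (k : ℕ) (g : ℕ → ℚ) : ∑ i ∈ Ioo 0 k, g i = ∑ j ∈ range (k - 1), g (j + 1) := by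
  rw [← Finset.Ico_succ_left_eq_Ioo, Order.succ_eq_add_one, Finset.sum_Ico_eq_sum_range]
  simp only [zero_add]
  exact Finset.sum_congr rfl (fun j _ => by rw [Nat.add_comm])

/-- **The first-difference identity** (`1 ≤ k`, `m ≤ q`): with `n = q + k − m`,
`Σ_{0<i<k} C(n−1, i)·W_i(q,m+1) = Σ_{0<i<k} C(n, i)·W_i(q,m) + C(n−1, k−1)·W_k(q,m) − W_1(q,m)`. -/
lemma rhatSumW_succ (q k m : ℕ) (hk : 1 ≤ k) (hm : m ≤ q) :
    ∑ i ∈ Ioo 0 k, ((q + k - (m + 1)).choose i : ℚ) * sumW q (m + 1) i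
      = ∑ i ∈ Ioo 0 k, ((q + k - m).choose i : ℚ) * sumW q m i
        + ((q + k - (m + 1)).choose (k - 1) : ℚ) * sumW q m k - sumW q m 1 := by
  obtain ⟨n, hn⟩ : ∃ n, q + k - m = n + 1 := ⟨q + k - m - 1, by omega⟩
  have hn' : q + k - (m + 1) = n := by omega
  obtain ⟨l, rfl⟩ : ∃ l, k = l + 1 := ⟨k - 1, by omega⟩
  rw [hn, hn', sumIooZeroRat, sumIooZeroRat, show l + 1 - 1 = l by omega]
  have hW : ∀ j, sumW q (m + 1) j = sumW q m j + sumW q m (j + 1) := fun j => by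
    have := sumW_succ q m j; linarith
  simp_rw [hW, mul_add, Finset.sum_add_distrib]
  have hshift : ∑ j ∈ range l, (n.choose (j + 1) : ℚ) * sumW q m (j + 1 + 1) + (n.choose 0 : ℚ) * sumW q m (0 + 1)
      = ∑ j ∈ range l, (n.choose j : ℚ) * sumW q m (j + 1) + (n.choose l : ℚ) * sumW q m (l + 1) := by
    rw [← Finset.sum_range_succ' (fun j => (n.choose j : ℚ) * sumW q m (j + 1)) l,
      Finset.sum_range_succ (fun j => (n.choose j : ℚ) * sumW q m (j + 1)) l]
  have hpascal : ∑ j ∈ range l, ((n + 1).choose (j + 1) : ℚ) * sumW q m (j + 1)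
      = ∑ j ∈ range l, (n.choose j : ℚ) * sumW q m (j + 1) + ∑ j ∈ range l, (n.choose (j + 1) : ℚ) * sumW q m (j + 1) := by
    rw [← Finset.sum_add_distrib]
    refine Finset.sum_congr rfl (fun j _ => ?_)
    rw [Nat.choose_succ_succ']
    push_cast
    ring
  rw [hpascal]
  simp only [Nat.choose_zero_right, Nat.cast_one, one_mul, zero_add] at hshift
  linarith

/-- **The sign of `δ` propagates**: for `3 ≤ k`, `m + k ≤ q`, if `C(q+k−m−1, k−1)·W_k(q,m) ≤ W_1(q,m)` then
`C(q+k−m−2, k−1)·W_k(q,m+1) ≤ W_1(q,m+1)` (from the monotone ratio `tilted_ratio_step`). -/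
lemma tilted_delta_propagate (q k m : ℕ) (hk : 3 ≤ k) (hmk : m + k ≤ q)
    (h : ((q + k - (m + 1)).choose (k - 1) : ℚ) * sumW q m k ≤ sumW q m 1) :
    ((q + k - (m + 2)).choose (k - 1) : ℚ) * sumW q (m + 1) k ≤ sumW q (m + 1) 1 := by
  obtain ⟨N, hN⟩ : ∃ N, q + k - (m + 1) = N + 1 := ⟨q + k - (m + 2), by omega⟩
  have hN' : q + k - (m + 2) = N := by omega
  rw [hN] at h
  rw [hN']
  -- the binomial step: `C(N, k−1) · (N+1) = C(N+1, k−1) · (q − m)`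
  have hb : (N.choose (k - 1) : ℚ) * ((N : ℚ) + 1) = ((N + 1).choose (k - 1) : ℚ) * ((q : ℚ) - m) := by
    have h1 := Nat.choose_mul_succ_eq N (k - 1)
    have h2 : N + 1 - (k - 1) = q - m := by omega
    rw [h2] at h1
    have h3 : ((N.choose (k - 1) * (N + 1) : ℕ) : ℚ) = (((N + 1).choose (k - 1) * (q - m) : ℕ) : ℚ) := by
      exact_mod_cast h1
    push_cast [Nat.cast_sub (show m ≤ q by omega)] at h3
    linarith
  have hr := tilted_ratio_step q k m hk hmk
  have hu : ((q : ℚ) - m + k - 1) = (N : ℚ) + 1 := by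
    have : (q + k - (m + 1) : ℕ) = N + 1 := hN
    have h' : ((q + k - (m + 1) : ℕ) : ℚ) = (N : ℚ) + 1 := by exact_mod_cast this
    rw [Nat.cast_sub (by omega)] at h'
    push_cast at h'
    linarith
  rw [hu] at hr
  have hW1 := sumW_pos q m 1
  have hW1' := sumW_pos q (m + 1) 1
  have hWk := sumW_pos q m k
  have hc : (0 : ℚ) ≤ ((N + 1).choose (k - 1) : ℚ) := by positivity
  have hNpos : (0 : ℚ) < (N : ℚ) + 1 := by positivity
  have key : ((N : ℚ) + 1) * sumW q m 1 * ((N.choose (k - 1) : ℚ) * sumW q (m + 1) k)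
      ≤ ((N : ℚ) + 1) * sumW q m 1 * sumW q (m + 1) 1 := by
    calc ((N : ℚ) + 1) * sumW q m 1 * ((N.choose (k - 1) : ℚ) * sumW q (m + 1) k)
        = ((N + 1).choose (k - 1) : ℚ) * (((q : ℚ) - m) * (sumW q (m + 1) k * sumW q m 1)) := by
          linear_combination (sumW q m 1 * sumW q (m + 1) k) * hb
      _ ≤ ((N + 1).choose (k - 1) : ℚ) * (((N : ℚ) + 1) * (sumW q m k * sumW q (m + 1) 1)) :=
          mul_le_mul_of_nonneg_left hr hc
      _ = ((N : ℚ) + 1) * sumW q (m + 1) 1 * (((N + 1).choose (k - 1) : ℚ) * sumW q m k) := by ring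
      _ ≤ ((N : ℚ) + 1) * sumW q (m + 1) 1 * sumW q m 1 := by
          apply mul_le_mul_of_nonneg_left h; positivity
      _ = ((N : ℚ) + 1) * sumW q m 1 * sumW q (m + 1) 1 := by ring
  exact le_of_mul_le_mul_left key (by positivity)

/-- A sequence with `F 0 = 0`, increments `δ` that, once non-positive, stay non-positive, and `F M ≥ 0` is non-negative
on `[0, M]` (it is unimodal, so bounded below by `min (F 0) (F M)`). -/
lemma tilted_unimodal_nonneg (F δ : ℕ → ℚ) (M : ℕ) (h0 : F 0 = 0) (hstep : ∀ m, m < M → F (m + 1) = F m + δ m)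
    (hprop : ∀ m, m + 1 < M → δ m ≤ 0 → δ (m + 1) ≤ 0) (hM : 0 ≤ F M) : ∀ m, m ≤ M → 0 ≤ F m := by
  have aux : ∀ j m, m + 1 + j = M → δ m ≤ 0 → F M ≤ F (m + 1) := by
    intro j
    induction j with
    | zero =>
      intro m hm _
      have hM' : M = m + 1 := by omega
      rw [hM']
    | succ j ih =>
      intro m hm hδ
      have hδ' : δ (m + 1) ≤ 0 := hprop m (by omega) hδ
      have h1 := ih (m + 1) (by omega) hδ'
      have h2 := hstep (m + 1) (by omega)
      linarith
  intro m
  induction m with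
  | zero => intro _; rw [h0]
  | succ m ih =>
    intro hm
    have hF := hstep m (by omega)
    rcases le_or_gt 0 (δ m) with hδ | hδ
    · have := ih (by omega); linarith
    · have := aux (M - (m + 1)) m (by omega) hδ.le; linarith

/-- **THE WHOLE UNTRUNCATED REGIME FROM ITS CORNER, UNIFORMLY IN `k`**: for `3 ≤ k ≤ q + 1`, if
`Φ(q+k, q) ≤ R̂(q, k, q+1−k)` (the corner `#P = q − k + 1`, `u = k − 1`) then `Φ(q+k, q) ≤ R̂(q, k, m)` for every `m ≤ q+1−k`. -/
theorem rhat_whole_of_corner (q k : ℕ) (hk : 3 ≤ k) (hqk : k ≤ q + 1)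
    (hcorner : phiK (q + k) q ≤ rhat q k (q + 1 - k)) :
    ∀ m, m + k ≤ q + 1 → phiK (q + k) q ≤ rhat q k m := by
  set M := q + 1 - k with hM
  let F : ℕ → ℚ := fun m => ∑ i ∈ Ioo 0 k, ((q + k - m).choose i : ℚ) * sumW q m i - phiK (q + k) q
  let δ : ℕ → ℚ := fun m => ((q + k - (m + 1)).choose (k - 1) : ℚ) * sumW q m k - sumW q m 1
  have hF : ∀ m, m + k ≤ q + 1 → F m = rhat q k m - phiK (q + k) q := fun m hm => by
    simp only [F]
    rw [rhat_eq_sumW q k m (by omega)]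
  have h0 : F 0 = 0 := by
    simp only [F]
    rw [phiK_eq_sum_Ioo q k (by omega), sub_eq_zero]
    refine Finset.sum_congr rfl (fun i _ => ?_)
    unfold sumW
    simp
  have hstep : ∀ m, m < M → F (m + 1) = F m + δ m := fun m hm => by
    simp only [F, δ]
    have := rhatSumW_succ q k m (by omega) (by omega)
    linarith
  have hprop : ∀ m, m + 1 < M → δ m ≤ 0 → δ (m + 1) ≤ 0 := fun m hm hδ => by
    simp only [δ] at hδ ⊢
    have h1 : ((q + k - (m + 1)).choose (k - 1) : ℚ) * sumW q m k ≤ sumW q m 1 := by linarith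
    have h2 := tilted_delta_propagate q k m hk (by omega) h1
    rw [show m + 1 + 1 = m + 2 by omega]
    linarith
  have hMnonneg : 0 ≤ F M := by
    rw [hF M (by omega)]
    linarith
  intro m hm
  have := tilted_unimodal_nonneg F δ M h0 hstep hprop hMnonneg m (by omega)
  rw [hF m hm] at this
  linarith

/-- The corner through the row `J = 1` (RankLevelSetRuleQFullUniform): for `3 ≤ k ≤ q + 1`, if
`(q+1)·(C(q+1−k, k) + C(2k−1, k)) ≤ k·C(q+k, k)` then `Φ(q+k,q) ≤ R̂(q,k,m)` for every `m ≤ q+1−k`. -/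
theorem rhat_whole_of_row_one_corner (q k : ℕ) (hk : 3 ≤ k) (hqk : k ≤ q + 1)
    (h : (q + 1) * ((q + 1 - k).choose k + (2 * k - 1).choose k) ≤ k * (q + k).choose k) :
    ∀ m, m + k ≤ q + 1 → phiK (q + k) q ≤ rhat q k m := by
  refine rhat_whole_of_corner q k hk hqk ?_
  refine rhat_ge_phiK_of_row_one q k (q + 1 - k) hk (by omega) (by omega) ?_
  rw [show q - (q + 1 - k) + k = 2 * k - 1 by omega, show q - (q + 1 - k) + 1 = k by omega]
  exact h

end PercRepro
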